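import Literature.AnabelianGeometry.EtaleTheta.Discharge.Sec5Thm57HK4famEOfProducedShadow
import Literature.AnabelianGeometry.EtaleTheta.Discharge.Sec5Thm57KummerTorsionOfEtaleTowerProducedHsepPow

/-!
# [EtTh] §5, Theorem 5.7 — the leanest (C)-display with `hK4famE'` (PRODUCED Thm. 5.6 data discharged) in the REPAIRED separation currency
# `hsep^{(2l)}` (pp. 324–334 / PDF pp. 98–108)

Mochizuki, *The étale theta function and its Frobenioid-theoretic manifestations*, Publ. RIMS **45** (2009)
[cite: MochizukiEtTh2009, Thm 5.7 p.329–330 (PDF pp.103–104); Thm 5.6 p.328 (PDF p.102); Thm 5.10 (ii) p.334 (PDF p.108); Cor 2.19 (iii)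
p.291 (PDF p.65); Prop 3.2 (iii) p.296 (PDF p.70); Prop 4.3 (i) p.317 (PDF p.91); Cor 2.18 (i) p.285–286 (PDF pp.59–60)]; [cite: MochizukiFrdI2008,
Prop. 5.6 p.105; Thm. 5.2 (i) p.100].  abc-iut cell, layer L2, node `EtTh:Thm5.7`; seat abc-iut-L2-d4 (gen 8), abc-iut-L2-lead R1212 «HSEP-POW TWINS
… @PRODUCED» (second half) after R1268/R1326.  PROOF-ONLY (0 definitions, 0 instances, 0 notation, 0 new named facts; nothing landed is edited
or restated).

WHAT.  `Sec5Thm57HK4famEOfProducedShadow.lean` (p509212) gives the leanest Thm. 5.7 (C)-display of record with Thm. 5.6 at each member reduced to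
`hK4famE'` = {(K4m) at `b`; the shadow law for every PRODUCED base shadow}, but in abc-iut-w6-d049's ORIGINAL cross-level separation currency
`hsep` (exponent `2`), which abc-iut-f-123 showed UNINHABITABLE at the Tate datum of record whenever `l ∣ p − 1` (p497402 / p498173) and REPAIRED
to exponent `2·l` (`hsep^{(2l)}`, p498016; inhabited at the Tate datum, p503064; abc-iut-L2-lead R1156/R1164/R1212).  THIS FILE is the twin of
p509212's Setting theorem in the repaired currency:
* `ThetaFrobenioidTower.thetaRootPreservedAll_ofThetaSettingYddFamily_final_v6_treeMonoidVocab_of_cor219iiiStd_of_mlf_of_kernel_of_hsepPow_hK4famE'`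
  — VERBATIM p509212's `…_of_mlf_of_kernel_hK4famE'` except that the separation binder `hsep` carries the exponent `2 * T.l` (binder text
  VERBATIM abc-iut-f-123's p504774) and the member chain runs through abc-iut-w6-d082's `kummerTorsion_of_etaleTower_ofProduced_of_hsepPow`
  (`Sec5Thm57KummerTorsionOfEtaleTowerProducedHsepPow.lean`; ⟸ f-123's `kummerTorsion_of_etaleTower_of_hsepPow`, p503919).
So the (C)-display of record exists with `hK4famE'` in BOTH separation currencies; with abc-iut-f-123's p506863 (`…_of_hsepPow`, `hK4fam`) the
repaired-currency displays differ exactly by `hK4fam ↦ hK4famE'`.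
HONEST FRAMING: kernel-checked composition of landed theorems for data so parametrised (no `TemperedFrobenioid` of an actual curve is constructed
in the tree); F-0620 / `Prop15iii` / the F-0652 SHAPE stay FACT-policy labels or named residuals; nothing of [EtTh] beyond the cited implications
is asserted unconditionally; typed ≠ discharged — PROVED modulo the displayed binders; no side taken on anything downstream ([IUTchIII] Cor. 3.12
in particular).
-/

noncomputable section

namespace Literature.AnabelianGeometry.EtaleTheta

open CategoryTheory Opposite Literature.AlgebraicGeometry.Frobenioids Literature.AnabelianGeometry.SemiGraphs
  Literature.AnabelianGeometry.SemiGraphs.GaloisObjects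

universe w v v' u u' u₀ v₀ u₁ v₁


namespace ThetaFrobenioidTower


section Setting

variable {p : ℕ} [Fact p.Prime] {DS : ThetaSetting p} {ES : DS.EtaleThetaData} {l' : ℕ} (Cu : ES.DoubleUnderline l')
  {e' : DS.toTemperedCurve.GroupLevelData} {Es : Set ℕ+} (τ : DS.CyclotomeTower l' Es) (hC : DS.Compat) (hS : DS.Sec2Hyps)
  {D₀ : Type} [Category.{v₀} D₀] {T₀ : RealifiedDivisorMonoids (D₀ := D₀) treeMonoidVocab.{0}}
  {VD : FrdICatStub.{1, 0, 0} (ConnectedPart (BTemp (Cu.temperedArithmeticGroup e').Pi))}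
  {tf : TemperedFrobenioid T₀ (ConnectedPart (BTemp (Cu.temperedArithmeticGroup e').Pi)) VD} {hZ : tf.monoidType = MonoidType.Z}
  {hP : ∀ A : (ConnectedPart (BTemp (Cu.temperedArithmeticGroup e').Pi))ᵒᵖ, IsPerfect (tf.Φ.carrier A)}
  {NH : Subgroup (Field.absoluteGaloisGroup DS.K) → tf.category → ℕ+ → Prop}
  {pullFrac : ∀ {A A' : (BiKummerSetting.mkOfConnectedTemperoidYddTower (Cu.temperedArithmeticGroup e') tf hZ hP NH (Cu.thetaEnvTower τ hC hS)
    (ContinuousMulEquiv.refl _)).C} (_ : A' ⟶ A), (BiKummerSetting.mkOfConnectedTemperoidYddTower (Cu.temperedArithmeticGroup e') tf hZ hP NH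
    (Cu.thetaEnvTower τ hC hS) (ContinuousMulEquiv.refl _)).biratUnits A → (BiKummerSetting.mkOfConnectedTemperoidYddTower
    (Cu.temperedArithmeticGroup e') tf hZ hP NH (Cu.thetaEnvTower τ hC hS) (ContinuousMulEquiv.refl _)).biratUnits A'}
  {θ : (BiKummerSetting.mkOfConnectedTemperoidYddTower (Cu.temperedArithmeticGroup e') tf hZ hP NH (Cu.thetaEnvTower τ hC hS)
    (ContinuousMulEquiv.refl _)).biratUnits (BiKummerSetting.mkOfConnectedTemperoidYddTower (Cu.temperedArithmeticGroup e') tf hZ hP NH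
    (Cu.thetaEnvTower τ hC hS) (ContinuousMulEquiv.refl _)).Aodot}
  {Bl : (BiKummerSetting.mkOfConnectedTemperoidYddTower (Cu.temperedArithmeticGroup e') tf hZ hP NH (Cu.thetaEnvTower τ hC hS)
    (ContinuousMulEquiv.refl _)).C}
  {Pl : (BiKummerSetting.mkOfConnectedTemperoidYddTower (Cu.temperedArithmeticGroup e') tf hZ hP NH (Cu.thetaEnvTower τ hC hS)
    (ContinuousMulEquiv.refl _)).FractionPair θ Bl}
  {Rl : (BiKummerSetting.mkOfConnectedTemperoidYddTower (Cu.temperedArithmeticGroup e') tf hZ hP NH (Cu.thetaEnvTower τ hC hS)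
    (ContinuousMulEquiv.refl _)).NthRoot θ Pl Cu.lPNat pullFrac}
  (h : ModelFrobenioid.Hypotheses tf.divisorMonoid tf.ratFnFunctor)
  (Q : FrobenioidTheta.ThetaSubquotientStub.{0} (ConnectedPart (BTemp (Cu.temperedArithmeticGroup e').Pi)))
  (R : ∀ N : ℕ+, (BiKummerSetting.mkOfConnectedTemperoidYddTower (Cu.temperedArithmeticGroup e') tf hZ hP NH (Cu.thetaEnvTower τ hC hS)
    (ContinuousMulEquiv.refl _)).NthRoot Rl.root Rl.pair N pullFrac)
  (K' : Type) [Field K'] {X₀ : ConnectedPart (BTemp (Cu.temperedArithmeticGroup e').Pi)}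
  (hX₀ : ∀ Y : ConnectedPart (BTemp (Cu.temperedArithmeticGroup e').Pi), Subsingleton (Y ⟶ X₀))
  (t : ∀ N : ℕ+, (R N).BN.base ⟶ X₀) (c₀ : K'ˣ →* (tf.ratFnFunctor.obj (op X₀))ˣ)
  (hc₀ : Function.Injective c₀) (ht : ∀ N : ℕ+, Function.Injective (tf.ratFnFunctor.map (t N).op).hom)
  (hinvc : ∀ (N : ℕ+) (g : Aut (R N).AN.base), pull tf.divisorMonoid g.hom (ModelFrobenioid.div (R N).pair.num) = ModelFrobenioid.div (R
    N).pair.num)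
  (hinvp : ∀ (N : ℕ+) (y : (Cu.thetaEnvTower τ hC hS).PiX), y ∈ (Cu.thetaEnvTower τ hC hS).PiYdd → pull tf.divisorMonoid
    ((BiKummerSetting.mkOfConnectedTemperoidYddTower (Cu.temperedArithmeticGroup e') tf hZ hP NH (Cu.thetaEnvTower τ hC hS) (ContinuousMulEquiv.refl
    _)).galoisSurj (R N).AN.base (R N).αData.isGalois ((ContinuousMulEquiv.refl _) y)).hom (ModelFrobenioid.div (R N).pair.den) =
    ModelFrobenioid.div (R N).pair.den)
  (α : ∀ {N N' : ℕ+}, (N : ℕ) ∣ N' → ((R N').AN ⟶ (R N).AN))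
  (β : ∀ {N N' : ℕ+}, (N : ℕ) ∣ N' → ((R N').BN ⟶ (R N).BN))
  (comm_sCap : ∀ {N N' : ℕ+} (hd : (N : ℕ) ∣ N'), (R N').pair.num ≫ β hd = α hd ≫ (R N).pair.num)
  (comm_sCup : ∀ {N N' : ℕ+} (hd : (N : ℕ) ∣ N'), (R N').pair.den ≫ β hd = α hd ≫ (R N).pair.den)
  (isIsometry_α : ∀ {N N' : ℕ+} (hd : (N : ℕ) ∣ N'), ((BiKummerSetting.mkOfConnectedTemperoidYddTower (Cu.temperedArithmeticGroup e') tf hZ hP NH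
    (Cu.thetaEnvTower τ hC hS) (ContinuousMulEquiv.refl _)).sec5Stub h).pre.IsIsometry (α hd))
  (degFr_α : ∀ {N N' : ℕ+} (hd : (N : ℕ) ∣ N'), (((BiKummerSetting.mkOfConnectedTemperoidYddTower (Cu.temperedArithmeticGroup e') tf hZ hP NH
    (Cu.thetaEnvTower τ hC hS) (ContinuousMulEquiv.refl _)).sec5Stub h).pre.degFr (α hd) : ℕ) * N = N')
  (isIsometry_β : ∀ {N N' : ℕ+} (hd : (N : ℕ) ∣ N'), ((BiKummerSetting.mkOfConnectedTemperoidYddTower (Cu.temperedArithmeticGroup e') tf hZ hP NH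
    (Cu.thetaEnvTower τ hC hS) (ContinuousMulEquiv.refl _)).sec5Stub h).pre.IsIsometry (β hd))
  (degFr_β : ∀ {N N' : ℕ+} (hd : (N : ℕ) ∣ N'), (((BiKummerSetting.mkOfConnectedTemperoidYddTower (Cu.temperedArithmeticGroup e') tf hZ hP NH
    (Cu.thetaEnvTower τ hC hS) (ContinuousMulEquiv.refl _)).sec5Stub h).pre.degFr (β hd) : ℕ) * N = N')
  (baseFrob_α : ∀ {N N' : ℕ+} (hd : (N : ℕ) ∣ N'), (BiKummerSetting.mkOfConnectedTemperoidYddTower (Cu.temperedArithmeticGroup e') tf hZ hP NH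
    (Cu.thetaEnvTower τ hC hS) (ContinuousMulEquiv.refl _)).IsOfBaseFrobeniusType (α hd))
  (h44 : BiKummerSetting.Thm44Hyp (BiKummerSetting.mkOfConnectedTemperoidYddTower (Cu.temperedArithmeticGroup e') tf hZ hP NH (Cu.thetaEnvTower τ hC
    hS) (ContinuousMulEquiv.refl _)) (BiKummerSetting.mkOfConnectedTemperoidYddTower (Cu.temperedArithmeticGroup e') tf hZ hP NH (Cu.thetaEnvTower τ
    hC hS) (ContinuousMulEquiv.refl _)))
  (ψ : ∀ A : (BiKummerSetting.mkOfConnectedTemperoidYddTower (Cu.temperedArithmeticGroup e') tf hZ hP NH (Cu.thetaEnvTower τ hC hS)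
    (ContinuousMulEquiv.refl _)).C, (BiKummerSetting.mkOfConnectedTemperoidYddTower (Cu.temperedArithmeticGroup e') tf hZ hP NH (Cu.thetaEnvTower τ
    hC hS) (ContinuousMulEquiv.refl _)).biratUnits A ≃* (BiKummerSetting.mkOfConnectedTemperoidYddTower (Cu.temperedArithmeticGroup e') tf hZ hP NH
    (Cu.thetaEnvTower τ hC hS) (ContinuousMulEquiv.refl _)).biratUnits (h44.Ψ.functor.obj A))
  (hpull : ∀ {A A' : (BiKummerSetting.mkOfConnectedTemperoidYddTower (Cu.temperedArithmeticGroup e') tf hZ hP NH (Cu.thetaEnvTower τ hC hS)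
    (ContinuousMulEquiv.refl _)).C} (φ : A' ⟶ A) (f : (BiKummerSetting.mkOfConnectedTemperoidYddTower (Cu.temperedArithmeticGroup e') tf hZ hP NH
    (Cu.thetaEnvTower τ hC hS) (ContinuousMulEquiv.refl _)).biratUnits A), ψ A' (pullFrac φ f) = pullFrac (h44.Ψ.functor.map φ) (ψ A f))
  (hii : BiKummerSetting.Thm44_ii h44 ψ) (h3 : h44.PreservesFrobeniusStructure) (h4b : h44.PreservesBaseFrobeniusTypeData)
  (h8 : h44.PreservesAmple) (h15a : h44.PreservesFixedByHA ψ) (h15 : h44.PreservesSaturated ψ)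
  (D : ∀ N : ℕ+, (BiKummerSetting.mkOfConnectedTemperoidYddTower (Cu.temperedArithmeticGroup e') tf hZ hP NH (Cu.thetaEnvTower τ hC hS)
    (ContinuousMulEquiv.refl _)).BaseFrobeniusTypeData (α (one_dvd_level N)))

include hX₀ h hc₀ ht comm_sCap comm_sCup isIsometry_α degFr_α isIsometry_β degFr_β hpull hii h3 h4b h8 h15a h15 D in
/-- (**REPAIRED separation binder**: `hsep` with exponent `2·l`; otherwise VERBATIM p509212.)  **[EtTh] Theorem 5.7 — FINAL KNIT v6 at the tower OF
THE SETTING (canonical vocabulary, (C) from the étale side, MLF constants, `hinvp` from the kernel `H_⊙`), Thm. 5.6 at each member reduced to {(K4m) at `b`, the shadow law for every PRODUCED base shadow}**: the display of FILE 1's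
`…_of_mlf_of_kernel_hK4famE` (p501804) with `hK4famE ↦ hK4famE'`, proved directly from abc-iut-f-123's `…_treeMonoidVocab_of_cor218_i` (`hK` := p480502,
`hinvp` := p483063, `hnd := hnd_of_thm44Hyp_treeMonoidVocab h44`, `hP24 := Cu.hP24_thetaEnvTower_of_cor218_i … h218i` (F-0620), `htorsfam` := per member
`hK4famE_of_producedShadow … hK4famE'` then p501240's `kummerTorsion_of_etaleTower_ofProduced` with `hδ` := p501240's `eq_of_transports_of_model`, the
tower's operations being the model's by `rfl`); every other binder VERBATIM p486421 thm 1.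
[cite: MochizukiEtTh2009, Thm 5.7 p.329–330 (PDF pp.103–104); Thm 5.10 (ii) p.334 (PDF p.108); Prop 3.2 (iii) p.296 (PDF p.70); Prop 4.3 (i) p.317 (PDF p.91); Cor 2.18 (i) p.285–286 (PDF pp.59–60)] -/
theorem thetaRootPreservedAll_ofThetaSettingYddFamily_final_v6_treeMonoidVocab_of_cor219iiiStd_of_mlf_of_kernel_of_hsepPow_hK4famE'
    (T : ThetaFrobenioidTower.{0} (BiKummerSetting.mkOfConnectedTemperoidYddTower (Cu.temperedArithmeticGroup e') tf hZ hP NH (Cu.thetaEnvTower τ hC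
      hS) (ContinuousMulEquiv.refl _)).C (ConnectedPart (BTemp (Cu.temperedArithmeticGroup e').Pi)))
    (hT : T = ofThetaSettingFamily τ hC hS h Q R K' (fun N => (Units.map (tf.ratFnFunctor.map (t N).op).hom).comp c₀) (fun N =>
      tf.unitsMap_comp_injective (t N) hc₀ (ht N)) hinvc (hinvp_family_ofConnectedTemperoidYddTower h R)
      α β comm_sCap comm_sCup isIsometry_α degFr_α isIsometry_β degFr_β baseFrob_α)
    -- (A) Lemma 5.8's geometric connectedness at EVERY level `N`: «a unit of `B_N` commuting with `s^⊓-gp_N(Im Π^tp_Y̲)` is a constant»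
    -- (displayed; its level-1 instance is what v1–v5 discharged from the ONE `ConstantsDictionary` junction binder)
    (hgc : ∀ (N : ℕ+) (u : (T.atLevel N).units (T.BN N)),
      (∀ y ∈ (T.atLevel N).imPiY, T.sgpCap N y * (u : Aut (T.BN N)) * (T.sgpCap N y)⁻¹ = u) →
        (T.atLevel N).unitsToBirat (T.BN N) u ∈ (T.constEmb N).range)
    {Dcnst : Type u₁} [Category.{v₁} Dcnst] (cnst : D₀ ⥤ Dcnst)
    (G : ConnectedPart (BTemp (Field.absoluteGaloisGroup DS.K)) ⥤ Dcnst)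
    (ecn : tf.base ⋙ cnst ≅ QuasiTemperoid.pushforward (Cu.temperedArithmeticGroup e').aug.toMonoidHom (Cu.temperedArithmeticGroup
      e').aug_surjective (Cu.temperedArithmeticGroup e').augIsOpenMap_holds ⋙ G)
    (hP34 : RealifiedDivisorMonoids.Prop34Cnst T₀ cnst)
    (hF : ∀ {B B' : (BiKummerSetting.mkOfConnectedTemperoidYddTower (Cu.temperedArithmeticGroup e') tf hZ hP NH (Cu.thetaEnvTower τ hC hS)
      (ContinuousMulEquiv.refl _)).C} (φ : B' ⟶ B) (y : (BiKummerSetting.mkOfConnectedTemperoidYddTower (Cu.temperedArithmeticGroup e') tf hZ hP NH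
      (Cu.thetaEnvTower τ hC hS) (ContinuousMulEquiv.refl _)).biratUnits B), pullFrac φ y = tf.pullFracModel φ y)
    (hαover : ∀ N : ℕ+, α (one_dvd_level N) ≫ (R 1).α = (R N).α)
    (hcharAN : ∀ N : ℕ+, IsTopCharacteristic (Cu.temperedArithmeticGroup e').Pi (galoisSurjOf (Cu.temperedArithmeticGroup e').isTempered (R
      N).AN.base.obj (R N).αData.isGalois).ker)
    (hdivA : ∀ αA : h44.Ψ.functor.obj (T.AN 1) ≅ T.AN 1, ∃ ε : Aut (T.AN 1), T.pre.div (αA.inv ≫ h44.Ψ.functor.map (T.sCap 1)) = T.pre.div (ε.hom ≫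
      T.sCap 1) ∧ T.pre.div (αA.inv ≫ h44.Ψ.functor.map (T.sCup 1)) = T.pre.div (ε.hom ≫ T.sCup 1))
    {N' : ℕ+} (μ' : DS.CyclotomeMod l' N') (h15iii : DS.Prop15iii ES hC) (L : Cu.CuspLabels)
    (h218i : (Cu.rigidData μ' hC hS h15iii L).Cor218_i)
    (hL : ∀ (A'' : (BiKummerSetting.mkOfConnectedTemperoidYddTower (Cu.temperedArithmeticGroup e') tf hZ hP NH (Cu.thetaEnvTower τ hC hS)
      (ContinuousMulEquiv.refl _)).C) (N : ℕ+) (g : A''.base ⟶ (R 1).AN.base) (ξ : tf.ratFnFunctor.obj (op (R 1).AN.base)),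
      (BiKummerSetting.mkOfConnectedTemperoidYddTower (Cu.temperedArithmeticGroup e') tf hZ hP NH (Cu.thetaEnvTower τ hC hS)
      (ContinuousMulEquiv.refl _)).IsFrobeniusTrivial A'' → (BiKummerSetting.mkOfConnectedTemperoidYddTower (Cu.temperedArithmeticGroup e') tf hZ
      hP NH (Cu.thetaEnvTower τ hC hS) (ContinuousMulEquiv.refl _)).IsNHSaturatedBsFld (BiKummerSetting.mkOfConnectedTemperoidYddTower
      (Cu.temperedArithmeticGroup e') tf hZ hP NH (Cu.thetaEnvTower τ hC hS) (ContinuousMulEquiv.refl _)).HodotBsFld A'' N →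
      divB tf.divisorMonoid tf.ratFnFunctor tf.divBNatTrans (op (R 1).AN.base) ξ = 1 → ∃ ζ : tf.ratFnFunctor.obj (op A''.base), ζ ^ (N : ℕ) =
      pull tf.ratFnFunctor g ξ)
    (h58N : ∀ (N : ℕ+) (c : K'ˣ), ∃ r : tf.biratUnitsModel (R N).BN,
      (r : tf.ratFnFunctor.obj (op (R N).BN.base)) ^ (N : ℕ) = (tf.ratFnFunctor.map (t N).op).hom (c₀ c : tf.ratFnFunctor.obj (op X₀)))
    -- (C) SUPPLIED BY THE ÉTALE SIDE (abc-iut-w6-d049 p478416): `⋂_N (K^×)^N = 1` (Prop 3.2 (iii)) stays displayed …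
    -- (C) Prop. 3.2 (iii) `⋂_N (K'^×)^N = 1` is NO LONGER A BINDER: `K'` is a finite extension of `ℚ_p` for the residue
    -- characteristic `p` OF THE SETTING (print p.322), and the clause is `MLFDivisible.units_eq_one_of_forall_exists_pow_eq` (p480502)
    [Algebra ℚ_[p] K'] [FiniteDimensional ℚ_[p] K']
    -- … the §5 ↔ §2 dictionary at every level `M ∈ Es` of the tower of the Setting (pins of a COMPATIBLE family `η`) …
    (ι : T.PiX ≃* (Cu.thetaEnvTower τ hC hS).PiX) (hι : ∀ y : T.PiX, y ∈ T.PiYdd ↔ ι y ∈ (Cu.thetaEnvTower τ hC hS).PiYdd)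
    (m : ∀ M : Es, (T.atLevel M).muTorsion (T.atLevel M).BN (T.atLevel M).N ≃* ((Cu.thetaEnvTower τ hC hS).level M).mu)
    (hχ : ∀ M : Es, (T.atLevel M).CyclotomicCharacterCompat ((Cu.thetaEnvTower τ hC hS).level M) ι (m M))
    (HF : ∀ M : Es, (T.atLevel M).Facts)
    (η : ∀ M : Es, (Cu.thetaEnvTower τ hC hS).PiYdd → (Cu.thetaEnvTower τ hC hS).mu M)
    (hη : ∀ M, η M ∈ (Cu.thetaEnvTower τ hC hS).thetaCocycles M)
    (hηc : ∀ (M M' : Es) (hd : (M : ℕ+) ∣ M'), (Cu.thetaEnvTower τ hC hS).red M M' hd ∘ η M' = η M)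
    (hpin : ∀ M : Es, (T.atLevel M).ThetaSectionCompat (HF M) ((Cu.thetaEnvTower τ hC hS).level M) ι (m M) hι (η M))
    -- … the étale data on the tower: `(γ, γ_μ)` with F-0652's conclusion SHAPE, glue, translation-freeness, separation across levels …
    (γ : (Cu.thetaEnvTower τ hC hS).PiX ≃ₜ* (Cu.thetaEnvTower τ hC hS).PiX)
    (hγ : (Cu.thetaEnvTower τ hC hS).PiYdd.map γ.toMulEquiv.toMonoidHom = (Cu.thetaEnvTower τ hC hS).PiYdd)
    (hγ' : ∀ x : (Cu.thetaEnvTower τ hC hS).PiX, x ∈ (Cu.thetaEnvTower τ hC hS).PiYdd → γ x ∈ (Cu.thetaEnvTower τ hC hS).PiYdd)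
    (γμ : ∀ M : Es, (Cu.thetaEnvTower τ hC hS).mu M ≃* (Cu.thetaEnvTower τ hC hS).mu M)
    (hstd : ∃ cf : ∀ M : Es, (Cu.thetaEnvTower τ hC hS).G → (Cu.thetaEnvTower τ hC hS).mu M,
      (∀ M, CycEnvelope.IsEnvCocycle (MonoidHom.id _) ((Cu.thetaEnvTower τ hC hS).chi M) (cf M)) ∧
      (∀ M, IsLocallyConstant (cf M ∘ (Cu.thetaEnvTower τ hC hS).aug)) ∧
      (∀ (M M' : Es) (hd : (M : ℕ+) ∣ M'), (Cu.thetaEnvTower τ hC hS).red M M' hd ∘ cf M' = cf M) ∧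
      (∀ M, (Cu.thetaEnvTower τ hC hS).pullbackCocycle M γ hγ (γμ M) '' (Cu.thetaEnvTower τ hC hS).thetaCocycles M =
        (fun η => η * (cf M ∘ (Cu.thetaEnvTower τ hC hS).aug ∘ (Cu.thetaEnvTower τ hC hS).PiYdd.subtype)) ''
          (Cu.thetaEnvTower τ hC hS).thetaCocycles M) ∧
      ∀ M : Es, ∃ d : (Cu.thetaEnvTower τ hC hS).mu M, ∀ g : (Cu.thetaEnvTower τ hC hS).G,
        cf M g ^ T.l = CycEnvelope.coboundary (MonoidHom.id _) ((Cu.thetaEnvTower τ hC hS).chi M) d g)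
    (hγμχ : ∀ (M : Es) (x : (Cu.thetaEnvTower τ hC hS).PiX) (tt : (Cu.thetaEnvTower τ hC hS).mu M),
      γμ M ((Cu.thetaEnvTower τ hC hS).chi M ((Cu.thetaEnvTower τ hC hS).aug x) tt) =
        (Cu.thetaEnvTower τ hC hS).chi M ((Cu.thetaEnvTower τ hC hS).aug (γ x)) (γμ M tt))
    (hγμred : ∀ (M M' : Es) (hd : (M : ℕ+) ∣ M') (tt : (Cu.thetaEnvTower τ hC hS).mu M'),
      (Cu.thetaEnvTower τ hC hS).red M M' hd (γμ M' tt) = γμ M ((Cu.thetaEnvTower τ hC hS).red M M' hd tt))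
    (haug : ∀ x y : (Cu.thetaEnvTower τ hC hS).PiX, (Cu.thetaEnvTower τ hC hS).aug x = (Cu.thetaEnvTower τ hC hS).aug y →
      (Cu.thetaEnvTower τ hC hS).aug (γ x) = (Cu.thetaEnvTower τ hC hS).aug (γ y))
    (hinfη : ∀ (M : Es) (k k' : (Cu.thetaEnvTower τ hC hS).PiYdd), (Cu.thetaEnvTower τ hC hS).aug k = (Cu.thetaEnvTower τ hC hS).aug k' →
      (η M k)⁻¹ * γμ M (η M ⟨γ.symm k, (Cu.thetaEnvTower τ hC hS).symm_apply_mem_PiYdd_of_map_eq γ hγ k k.2⟩) =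
        (η M k')⁻¹ * γμ M (η M ⟨γ.symm k', (Cu.thetaEnvTower τ hC hS).symm_apply_mem_PiYdd_of_map_eq γ hγ k' k'.2⟩))
    -- separation across levels, REPAIRED exponent `2·l` (abc-iut-f-123's `hsep^{(2l)}`, p498016 / p504774)
    (hsep : ∀ η' : ∀ M : Es, (Cu.thetaEnvTower τ hC hS).PiYdd → (Cu.thetaEnvTower τ hC hS).mu M,
      (∀ M, η' M ∈ (Cu.thetaEnvTower τ hC hS).thetaCocycles M) →
      (∀ (M M' : Es) (hd : (M : ℕ+) ∣ M'), (Cu.thetaEnvTower τ hC hS).red M M' hd ∘ η' M' = η' M) →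
      (∀ (M : Es) (k k' : (Cu.thetaEnvTower τ hC hS).PiYdd), (Cu.thetaEnvTower τ hC hS).aug k = (Cu.thetaEnvTower τ hC hS).aug k' →
        η' M k * (η M k)⁻¹ = η' M k' * (η M k')⁻¹) →
      ∀ M : Es, ∃ d : (Cu.thetaEnvTower τ hC hS).mu M, ∀ k : (Cu.thetaEnvTower τ hC hS).PiYdd,
        (η' M k * (η M k)⁻¹) ^ (2 * T.l) =
          CycEnvelope.coboundary ((Cu.thetaEnvTower τ hC hS).aug.comp (Cu.thetaEnvTower τ hC hS).PiYdd.subtype)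
            ((Cu.thetaEnvTower τ hC hS).chi M) d k)
    -- … and, of Thm. 5.6 at each member, ONLY: (K4m) at `b` and the shadow law for EVERY produced base shadow `θb` (with `e`, `D_c`, `D_p`, (1)–(5))
    (hK4famE' : ∀ (α₁ : h44.Ψ.functor.obj (T.AN 1) ≅ T.AN 1) (β₁ : h44.Ψ.functor.obj (T.BN 1) ≅ T.BN 1) (u₁ : Aut (T.BN 1))
      (hu₁ : u₁ ∈ (T.atLevel 1).units (T.BN 1)),
      α₁.inv ≫ h44.Ψ.functor.map (T.sCap 1) ≫ β₁.hom = T.sCap 1 →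
      α₁.inv ≫ h44.Ψ.functor.map (T.sCup 1) ≫ β₁.hom = T.sCup 1 ≫ u₁.hom →
      ∀ c : T.Kˣ, (T.atLevel 1).unitsToBirat (T.BN 1) ⟨u₁, hu₁⟩ = T.constEmb 1 c →
      ∀ N (hN : N ∈ Es), ∀ (a : h44.Ψ.functor.obj (T.AN N) ≅ T.AN N) (b : h44.Ψ.functor.obj (T.BN N) ≅ T.BN N) (w : Aut (T.BN N)),
        w ∈ (T.atLevel N).units (T.BN N) →
        a.inv ≫ h44.Ψ.functor.map (T.sCap N) ≫ b.hom = T.sCap N →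
        a.inv ≫ h44.Ψ.functor.map (T.sCup N) ≫ b.hom = T.sCup N ≫ w.hom →
        a.inv ≫ h44.Ψ.functor.map (T.α (one_dvd_level N)) ≫ α₁.hom = T.α (one_dvd_level N) →
        b.inv ≫ h44.Ψ.functor.map (T.β (one_dvd_level N)) ≫ β₁.hom = T.β (one_dvd_level N) →
          (∀ x : (Cu.thetaEnvTower τ hC hS).mu ⟨N, hN⟩, (T.atLevel N).psiAut h44.Ψ b
                (((m ⟨N, hN⟩).symm x : (T.atLevel N).muTorsion (T.atLevel N).BN (T.atLevel N).N) : Aut (T.atLevel N).BN) =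
              (((m ⟨N, hN⟩).symm (γμ ⟨N, hN⟩ x) : (T.atLevel N).muTorsion (T.atLevel N).BN (T.atLevel N).N) :
                Aut (T.atLevel N).BN)) ∧
          ∀ (θb : Aut (T.pre.base.obj (T.BN N)) ≃* Aut (T.pre.base.obj (T.BN N))) (e : T.AN N ≅ T.AN N),
            e ∈ (T.atLevel N).units (T.AN N) → ∀ Dc Dp : Aut (T.BN N),
            a.inv ≫ h44.Ψ.functor.map (T.sCap N) ≫ (b ≪≫ Dc.symm).hom = e.hom ≫ T.sCap N ≫ (1 : Aut (T.BN N)).hom →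
            a.inv ≫ h44.Ψ.functor.map (T.sCup N) ≫ (b ≪≫ Dc.symm).hom = e.hom ≫ T.sCup N ≫ Dp.hom →
            Dp ∈ (T.atLevel N).units (T.BN N) → (T.atLevel N).StrvTransport h44.Ψ a e θb →
            (T.atLevel N).HB.map θb.toMonoidHom = (T.atLevel N).HB →
              ∀ k : T.PiYdd, θb (T.ρ N k) = T.ρ N (ι.symm (γ (ι k)))) :
    T.ThetaRootPreservedAll h44.Ψ := by
  -- Prop. 3.2 (iii) for the MLF `K'`, read on `T.K` (which IS `K'` along `hT`; `rw` on the small goal, not `subst`)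
  have hK : ∀ x : T.Kˣ, (∀ N : ℕ+, ∃ d : T.Kˣ, d ^ (N : ℕ) = x) → x = 1 := by
    rw [hT]
    exact MLFDivisible.units_eq_one_of_forall_exists_pow_eq p K'
  refine thetaRootPreservedAll_ofThetaSettingYddFamily_final_v6_treeMonoidVocab_of_cor218_i Cu τ hC hS h Q R K' hX₀ t c₀ hc₀ ht hinvc
    (hinvp_family_ofConnectedTemperoidYddTower h R) α β comm_sCap comm_sCup isIsometry_α degFr_α isIsometry_β degFr_β baseFrob_α h44 ψ hpull
    hii h3 h4b h8 h15a h15 D T hT hgc cnst G ecn hP34 hF hαover hcharAN hdivA μ' h15iii L h218i hL h58N hK ?_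
  intro α₁ β₁ u₁ hu₁ h₁ h₂ c hc N hN a b w hw hTa hTb hΨa hΨb
  -- every level of the tower of the Setting has the model's operations (`rfl` along `hT`), `Φ` divisorial: p501240's clause `hδ` is a theorem here
  have h𝔗 : T.pre = PreFrobenioidData.ofModel _ _ _ := by
    rw [hT]; rfl
  have hΦd : Objectwise (fun M _ => IsDivisorial M) (BiKummerSetting.mkOfConnectedTemperoidYddTower
      (Cu.temperedArithmeticGroup e') tf hZ hP NH (Cu.thetaEnvTower τ hC hS) (ContinuousMulEquiv.refl _)).tf.divisorMonoid :=
    h.isDivisorial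
  have hδN : ∀ {e' : T.AN N ≅ T.AN N} {w' Dc' Dp' : Aut (T.BN N)}, e' ∈ (T.atLevel N).units (T.AN N) →
      w' ∈ (T.atLevel N).units (T.BN N) → Dp' ∈ (T.atLevel N).units (T.BN N) → T.sCap N ≫ Dc'.inv = e'.hom ≫ T.sCap N →
      T.sCup N ≫ w'.hom ≫ Dc'.inv = e'.hom ≫ T.sCup N ≫ Dp'.hom → w' = Dp' :=
    fun he' hw' hDp' h₁' h₂' => T.eq_of_transports_of_model h𝔗 hΦd he' hw' hDp' h₁' h₂'
  -- conjuncts (1)–(5) PRODUCED at the member (this file), then the (C)-chain for the produced data (p501240); `Exists.elim` keeps the unifier cheap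
  exact (hK4famE_of_producedShadow (𝒯 := Cu.thetaEnvTower τ hC hS) h Q Cu.odd_lPNat R (ContinuousMulEquiv.refl _) K'
      (fun N => (Units.map (tf.ratFnFunctor.map (t N).op).hom).comp c₀) (fun N => tf.unitsMap_comp_injective (t N) hc₀ (ht N)) hinvc
      (hinvp_family_ofConnectedTemperoidYddTower h R) α β comm_sCap comm_sCup isIsometry_α degFr_α isIsometry_β degFr_β baseFrob_α T hT
      (hnd_of_thm44Hyp_treeMonoidVocab h44) (Cu.hP24_thetaEnvTower_of_cor218_i τ hC hS μ' h15iii L h218i) h44.Ψ ι γ m γμ hK4famE' α₁ β₁ u₁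
      hu₁ h₁ h₂ c hc N hN a b w hw hTa hTb hΨa hΨb).elim fun θb hθ => hθ.elim fun e he => he.2.elim fun Dc hc' => hc'.elim fun Dp hp =>
    T.kummerTorsion_of_etaleTower_ofProduced_of_hsepPow h44.Ψ (Cu.thetaEnvTower τ hC hS) ι hι m hχ HF η hη hηc hpin γ hγ hγ' γμ hstd hγμχ hγμred
      haug hinfη hsep hN a b w hw hTa hTb θb e he.1 Dc Dp hp.1 hp.2.1 hp.2.2.1 hp.2.2.2.1 hp.2.2.2.2.1 hp.2.2.2.2.2.1 hp.2.2.2.2.2.2 hδN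

end Setting

end ThetaFrobenioidTower
end Literature.AnabelianGeometry.EtaleTheta
end
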